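import Summits.QuantumFields.BalabanUV.Beta.D1BFx.TorusCombKKT
import Summits.QuantumFields.BalabanUV.Beta.AxialDressingRootedBmReflection

/-!
# `BalabanUV.Beta.D1BFx.TorusGaugeBasis` — road «BF-x», binder row D1, slot (K), X₃(ii) ROUTE T, brick **K-TB3b «THE GAUGE BASIS FROM THE COMB ON
# THE TORUS»** PART 1 (K-ASSEMBLY-SPEC v2.1 §2 row K-TB3b; owner SHAPE journal l.22310, claim l.22580): the periodised block-mean projector `Π̂`
# in the sorted currency, the gauge-basis matrix `Ŵ₀ := (1 − Π̂)·τ_Tᵀ`, and the torus Ward letters **`τ_T·Ŵ₀ = 1`**, **`K̂·Ŵ₀ = 0`**, **`𝒬̂·Ŵ₀ = 0`**,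
# **`Ŵ₀·τ_T = 1 − Π̂`**

CONVENTION.  The tree states the blindness of the bordered Hessian for the TRANSPOSED block-mean kernel — `BorderedHessianBlind.comp_bhK_trK_piKBm :
bhK N ∘ (piKBm ρ N)ᵀ = bhK N` — and reads `piKBm ρ N z y (inl β) (inl l) = (Π_bm δ_{(β,z)})_l(y)` (`piKBm_inl_inl_eq`: first index = input).  So the
matrix the torus blocks `K̂ = TorusCombKKT.Khat`, `𝒬̂ = TorusCombKKT.Qhat` are blind to ON THE RIGHT, and whose COMB ROWS vanish, is
`Π̂ := (fTL (sortK n (trK (piKBm ρ n))))^`; `PiHat_eq_transpose` records that it is the transpose of `(fTL (sortK n (piKBm ρ n)))^`.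

CONTENT ([folklore] finite linear algebra + the cell's periodisation bookkeeping; in-block root `ρ = toSite r`, `r ∈ box (d+1) n`):
* §1 [our object] `PiHat`, `What0 := (1 − PiHat) * tauTᵀ`; `PiHat_eq_transpose`.
* §2 `PiHat_apply_of_comb` (comb rows of `Π̂` vanish — `pmBm_eq_zero_of_isCombBond`), `PiHat_apply_of_not_comb` (a non-comb column of `Π̂` is the
  unit vector — `axialGaugeAt_delta1_of_not_isCombBond` + `axProjBmAt_eq_self_of_axialGaugeAt`), **`tauT_mul_PiHat : τ_T·Π̂ = 0`**,
  **`tauT_mul_What0 : τ_T·Ŵ₀ = 1`** (+ `TorusCombKKT.tauT_mul_transpose`), `isUnit_det_tauT_mul_What0` (the `hτ` of K-TA4G),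
  `PiHat_mul_one_sub`, `one_sub_PiHat_mul_one_sub : (1 − Π̂)·(1 − τ_Tᵀτ_T) = 0`, **`What0_mul_tauT : Ŵ₀·τ_T = 1 − Π̂`**.
* §3 `periodise_sortK_comp'` (the `SortedRelInv` product rule with the off-lattice hypothesis on the LEFT factor's multiplier columns),
  `fBL_sortK_trK_piKBm` (the mf block of the sorted `Π̂` vanishes), `blocksHat_bhK_mul` (`(sortK bhK)^·(sortK Πᵀ)^ = (sortK bhK)^`),
  **`Khat_mul_PiHat : K̂·Π̂ = K̂`**, **`Qhat_mul_PiHat : 𝒬̂·Π̂ = 𝒬̂`**, hence **`Khat_mul_What0 = 0`**, **`Qhat_mul_What0 = 0`** — the Ward letters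
  (a0), (b0) of K-TA4G on the torus.
NOT HERE: the block-mean-free basis matrix `Nhat` and `What0 = ĝrad·Nhat` (PART 2), the weight `tauP`, `Amat`, the projector formula and the junction
(FILE 2 `TorusGaugeWeight`).

HONEST FRAMING (cell contract, verbatim): «discharging `BetaPertH` makes Bałaban's UV stability UNCONDITIONAL — a real constructive-QFT result; it
is NOT the continuum limit and NOT the Clay problem.»  HONEST DEPENDENCY (verbatim): «continuum YM on T⁴ ⇐ BetaPertH ∧ nine spine estimates (0/9
proved); BetaPertH ⇐ (D1) ∧ (D4) ∧ CAP+tail; G-an2-4 gates asym, D1 and NE2/3/4.»  [folklore] bookkeeping BY NAME; no `Prop` is minted, nothing is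
cited, no wall binder is instantiated; 0 sorry.  NOT D1, NOT BetaPertH.  ABSOLUTE RULE (cell, verbatim): «No internally-minted statement may enter as
a cited fact. Every hypothesis is either kernel-proved in this package or a verbatim quotation of a PUBLISHED theorem with page reference. The
manuscript(s) under audit are NOT citable for their own disputed steps — they are the thing under adjudication; programme-internal
(2001/route/tribunal) claims are never citable.»  Provenance: D1 formalisation swarm, unit `b2b-balaban-beta-d1-formalise-leaf-03` (gen 8), 2026-08-20.
-/

noncomputable section

namespace Summit.QuantumFields.BalabanUV.Beta.D1BFx.TorusGaugeBasis

open Matrix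
open Literature.Probability.LatticeModels (TorusSite Torus.proj)
open Literature.MathematicalPhysics.QuantumFieldTheory.LatticeForm (repZ quo)
open Literature.MathematicalPhysics.QuantumFieldTheory.Balaban1983to89
open Literature.MathematicalPhysics.QuantumFieldTheory.Balaban1983to89.Beta
open ExpKernelCalculus (MKer Decays comp shiftK)
open AffineAveraging (box toSite)
open KKTFluctuationKernel (delta1 delta1_apply)
open OneStepResolventKernel (Fib)
open Summit.QuantumFields.BalabanUV.Beta.TameKernelCalculus (Spr trK trK_apply)
open Summit.QuantumFields.BalabanUV.Beta.AxialDressingRooted (IsCombBondAt piKBm piKBm_inl_inl piKBm_inl_inr pmBm_eq_zero_of_isCombBond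
  shiftK_piKBm spr_trK_piKBm)
open Summit.QuantumFields.BalabanUV.Beta.AxialProjectorBlockMean (axProjBmAt_eq_self_of_axialGaugeAt)
open Summit.QuantumFields.BalabanUV.Beta.BorderedHessian (bhK spr_bhK bhK_inr_col_off comp_bhK_trK_piKBm piKBm_inl_inl_eq
  axialGaugeAt_delta1_of_not_isCombBond)
open Summit.QuantumFields.BalabanUV.Beta.D1BFx.FibredPeriodisation
open Summit.QuantumFields.BalabanUV.Beta.D1BFx.SortedKernels
open Summit.QuantumFields.BalabanUV.Beta.D1BFx.SortedReblocking
open Summit.QuantumFields.BalabanUV.Beta.D1BFx.SortedPack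
open Summit.QuantumFields.BalabanUV.Beta.D1BFx.SortedRelInv
open Summit.QuantumFields.BalabanUV.Beta.D1BFx.TorusCombKKT (I J CombRows tauT tauT_apply tauT_mul_transpose one_sub_transpose_mul_tauT_apply
  isCombBondAt_finePt_iff Khat Qhat)
open scoped BigOperators

variable {d : ℕ} (r : Fin (d + 1) → ℕ) (n p : ℕ) [NeZero n] [NeZero p]

/-! ## §1 The periodised block-mean projector and the gauge-basis matrix -/

/-- [our object] **`Π̂`**: the ff block of the periodised sorted TRANSPOSED block-mean kernel `(piKBm (toSite r) n)ᵀ` on the coarse torus of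
period `p` (index `ν = I d n p`). -/
def PiHat : Matrix (I d n p) (I d n p) ℝ := Matrix.of (periodiseF p (fTL (sortK n (trK (piKBm (toSite r) n)))))

/-- [our object] **`Ŵ₀ := (1 − Π̂)·τ_Tᵀ`**: column `b` = `δ_b − Π̂ᵀ-image` = the gradient of the block-mean-free comb gauge function of the comb
bond `b` (the basis of the gauge slice used by K-TA4G). -/
def What0 : Matrix (I d n p) (CombRows (toSite r) n p) ℝ := (1 - PiHat r n p) * (tauT (toSite r) n p)ᵀ

/-- [folklore] The transposed block-mean kernel is block covariant. -/
theorem shiftK_trK_piKBm (t : Fin (d + 1) → ℤ) : shiftK ((n : ℤ) • t) (trK (piKBm (toSite r) n)) = trK (piKBm (toSite r) n) := by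
  refine blockCov_of_neg (fun t => ?_) t
  show trK (shiftK (-((n : ℤ) • t)) (piKBm (toSite r) n)) = _
  rw [shiftK_piKBm _ (NeZero.one_le (n := n))]

/-- [folklore] **THE TRANSPOSED READING**: `Π̂ = ((fTL (sortK n (piKBm ρ n)))^)ᵀ`. -/
theorem PiHat_eq_transpose :
    PiHat r n p = (Matrix.of (periodiseF p (fTL (sortK n (piKBm (toSite r) n)))))ᵀ := by
  rw [← periodiseF_trF (fun a b => isPeriodic₂_sortK (blockCov_of_neg fun t => shiftK_piKBm _ (NeZero.one_le (n := n)) t) p (Sum.inl a) (Sum.inl b))]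
  rfl

/-! ## §2 Comb rows and non-comb columns of `Π̂`; `τ_T·Ŵ₀ = 1`, `Ŵ₀·τ_T = 1 − Π̂` -/

/-- [folklore] **THE COMB ROWS OF `Π̂` VANISH** (`Π_bm` lands in the rooted axial gauge: `pmBm_eq_zero_of_isCombBond`). -/
theorem PiHat_apply_of_comb (i j : I d n p) (hi : IsCombBondAt (toSite r) n i.2.2 (repZ i.2.1)) : PiHat r n p i j = 0 := by
  obtain ⟨x, z, α⟩ := i
  obtain ⟨y, z', β⟩ := j
  rw [PiHat, Matrix.of_apply, periodiseF_apply]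
  unfold periodise₂
  rw [show (fun t : Fin (d + 1) → ℤ => Kfib (fTL (sortK n (trK (piKBm (toSite r) n)))) (z, α) (z', β) (windowMap (d + 1) p x)
        (imageShift p (windowMap (d + 1) p y) t)) = fun _ => 0 from funext fun t => ?_]
  · exact tsum_zero
  · rw [Kfib_apply]
    show sortK n (trK (piKBm (toSite r) n)) (_, Sum.inl (z, α)) (_, Sum.inl (z', β)) = 0
    rw [sortK_inl_inl, trK_apply, piKBm_inl_inl]
    split_ifs
    · exact pmBm_eq_zero_of_isCombBond ((isCombBondAt_finePt_iff (toSite r) n α _ z).2 hi) _ _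
    · rfl

/-- [folklore] **A NON-COMB COLUMN OF `Π̂` IS THE UNIT VECTOR**: the indicator of a non-comb bond is in the rooted axial gauge, so `Π_bm` fixes it
(`axialGaugeAt_delta1_of_not_isCombBond`, `axProjBmAt_eq_self_of_axialGaugeAt`; in-block root). -/
theorem PiHat_apply_of_not_comb (hr : r ∈ box (d + 1) n) (i j : I d n p) (hj : ¬ IsCombBondAt (toSite r) n j.2.2 (repZ j.2.1)) :
    PiHat r n p i j = if i = j then 1 else 0 := by
  obtain ⟨x, z, α⟩ := i
  obtain ⟨y, z', β⟩ := j
  rw [← periodiseF_kdeltaF, PiHat, Matrix.of_apply, periodiseF_apply, periodiseF_apply]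
  unfold periodise₂
  refine tsum_congr fun t => ?_
  rw [Kfib_apply, Kfib_apply]
  show sortK n (trK (piKBm (toSite r) n)) (_, Sum.inl (z, α)) (_, Sum.inl (z', β)) = _
  have hc : ¬ IsCombBondAt (toSite r) n β (finePt n (imageShift p (windowMap (d + 1) p y) t) z') := by
    rwa [isCombBondAt_finePt_iff]
  rw [sortK_inl_inl, trK_apply, piKBm_inl_inl_eq (NeZero.one_le (n := n)) hr,
    axProjBmAt_eq_self_of_axialGaugeAt (NeZero.one_le (n := n)) (axialGaugeAt_delta1_of_not_isCombBond (NeZero.one_le (n := n)) hr hc), delta1_apply, kdeltaF]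
  simp only [finePt_eq_iff, Prod.mk.injEq]
  by_cases h1 : α = β
  · by_cases h2 : windowMap (d + 1) p x = imageShift p (windowMap (d + 1) p y) t
    · by_cases h3 : z = z'
      · simp [h1, h2, h3]
      · simp [h3]
    · simp [h2]
  · simp [h1]

/-- [folklore] **`τ_T·Π̂ = 0`** (the comb rows of `Π̂` vanish). -/
theorem tauT_mul_PiHat : tauT (toSite r) n p * PiHat r n p = 0 := by
  ext rr j
  rw [Matrix.mul_apply, Matrix.zero_apply]
  simp only [tauT_apply, ite_mul, one_mul, zero_mul, Finset.sum_ite_eq', Finset.mem_univ, if_true]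
  exact PiHat_apply_of_comb r n p _ _ rr.2

/-- [folklore] **`τ_T·Ŵ₀ = 1`**. -/
theorem tauT_mul_What0 : tauT (toSite r) n p * What0 r n p = 1 := by
  rw [What0, ← Matrix.mul_assoc, Matrix.mul_sub, Matrix.mul_one, tauT_mul_PiHat, sub_zero, tauT_mul_transpose]

/-- [folklore] Hence `det (τ_T·Ŵ₀)` is a unit — the `hτ` of K-TA4G. -/
theorem isUnit_det_tauT_mul_What0 : IsUnit (tauT (toSite r) n p * What0 r n p).det := by
  rw [tauT_mul_What0, Matrix.det_one]
  exact isUnit_one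

open Classical in
/-- [folklore] **`Π̂·(1 − τ_Tᵀτ_T) = 1 − τ_Tᵀτ_T`**: `Π̂` is the identity on the non-comb coordinates (in-block root). -/
theorem PiHat_mul_one_sub (hr : r ∈ box (d + 1) n) :
    PiHat r n p * (1 - (tauT (toSite r) n p)ᵀ * tauT (toSite r) n p) = 1 - (tauT (toSite r) n p)ᵀ * tauT (toSite r) n p := by
  ext i j
  rw [Matrix.mul_apply, one_sub_transpose_mul_tauT_apply]
  simp only [one_sub_transpose_mul_tauT_apply, mul_ite, mul_one, mul_zero]
  by_cases hc : IsCombBondAt (toSite r) n j.2.2 (repZ j.2.1)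
  · rw [Finset.sum_eq_zero]
    · split_ifs with h
      · exact absurd (h.1 ▸ hc) (h.1 ▸ h.2)
      · rfl
    · intro k _
      split_ifs with h
      · exact absurd (h.1 ▸ hc) (h.1 ▸ h.2)
      · rfl
  · rw [Finset.sum_eq_single j]
    · rw [if_pos ⟨rfl, hc⟩, PiHat_apply_of_not_comb r n p hr i j hc]
      by_cases hij : i = j
      · subst hij; simp [hc]
      · simp [hij]
    · intro k _ hk
      rw [if_neg (fun h => hk h.1)]
    · intro h; exact absurd (Finset.mem_univ _) h

/-- [folklore] **`(1 − Π̂)·(1 − τ_Tᵀτ_T) = 0`**: `1 − Π̂` only sees the comb coordinates. -/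
theorem one_sub_PiHat_mul_one_sub (hr : r ∈ box (d + 1) n) :
    (1 - PiHat r n p) * (1 - (tauT (toSite r) n p)ᵀ * tauT (toSite r) n p) = 0 := by
  rw [Matrix.sub_mul, Matrix.one_mul, PiHat_mul_one_sub r n p hr, sub_self]

/-- [folklore] **`Ŵ₀·τ_T = 1 − Π̂`**. -/
theorem What0_mul_tauT (hr : r ∈ box (d + 1) n) : What0 r n p * tauT (toSite r) n p = 1 - PiHat r n p := by
  have h := one_sub_PiHat_mul_one_sub r n p hr
  rw [Matrix.mul_sub, Matrix.mul_one, sub_eq_zero] at h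
  rw [What0, Matrix.mul_assoc, ← h]

/-! ## §3 Right blindness of `K̂` and `𝒬̂` to `Π̂`; the Ward letters `K̂·Ŵ₀ = 0`, `𝒬̂·Ŵ₀ = 0` -/

section Blind
variable {D : ℕ} {F : Type*} [Fintype F] {m : ℕ} [NeZero m] {q : ℕ} [NeZero q]

/-- [folklore] The `SortedRelInv` product rule with the off-lattice hypothesis on the LEFT factor's multiplier COLUMNS
(`SortedPack.sortK_comp'`): `(sortK (A ∘ K))^ = (sortK A)^ · (sortK K)^`. -/
theorem periodise_sortK_comp' {A K : MKer D (F ⊕ F)} (hA : Spr A) (hK : Spr K)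
    (hKc : ∀ t : Fin D → ℤ, shiftK ((m : ℤ) • t) K = K) (hAo : ∀ x y a f, Torus.proj m y ≠ 0 → A x y a (Sum.inr f) = 0) :
    Matrix.of (periodiseF q (sortK m (comp A K))) = Matrix.of (periodiseF q (sortK m A)) * Matrix.of (periodiseF q (sortK m K)) := by
  obtain ⟨B, hB⟩ := hyp_bound (n := m) hK
  rw [sortK_comp' hA.tame hK.tame hAo]
  exact periodiseF_compF_matrix (hyp_rows hA) (hyp_per hKc q) hB

end Blind

omit [NeZero n] in
/-- [folklore] The mf block of the sorted transposed block-mean kernel vanishes (`piKBm_inl_inr`). -/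
theorem fBL_sortK_trK_piKBm : fBL (sortK n (trK (piKBm (toSite r) n))) = fun _ _ => (0 : ℝ) := by
  funext ⟨x, mm⟩ ⟨y, z, b⟩
  show sortK n (trK (piKBm (toSite r) n)) (x, Sum.inr mm) (y, Sum.inl (z, b)) = 0
  rw [sortK_inr_inl, trK_apply, piKBm_inl_inr]

/-- [folklore] **`(sortK bhK)^ · (sortK Π̂ᵀ)^ = (sortK bhK)^`** on every coarse torus (`comp_bhK_trK_piKBm` periodised; in-block root). -/
theorem blocksHat_bhK_mul (hr : r ∈ box (d + 1) n) :
    blocksHat p (sortK n (bhK (d := d) n)) * blocksHat p (sortK n (trK (piKBm (toSite r) n))) = blocksHat p (sortK n (bhK (d := d) n)) := by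
  have h := periodise_sortK_comp' (q := p) (spr_bhK (d := d) (NeZero.one_le (n := n))) (spr_trK_piKBm (NeZero.one_le (n := n)) hr) (shiftK_trK_piKBm r n)
    (fun x y a f hy => bhK_inr_col_off _ hy x a f)
  rw [comp_bhK_trK_piKBm hr] at h
  rw [blocksHat_eq_reindex, blocksHat_eq_reindex, Matrix.reindex_apply, Matrix.reindex_apply, Matrix.submatrix_mul_equiv, ← h]

/-- [folklore] The block identities: `K̂·Π̂ = K̂` (ff) and `𝒬̂·Π̂ = 𝒬̂` (mf). -/
theorem Khat_mul_PiHat_and (hr : r ∈ box (d + 1) n) :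
    Khat (d := d) n p * PiHat r n p = Khat (d := d) n p ∧ Qhat (d := d) n p * PiHat r n p = Qhat (d := d) n p := by
  have h := blocksHat_bhK_mul r n p hr
  rw [blocksHat, blocksHat, Matrix.fromBlocks_multiply, fBL_sortK_trK_piKBm, periodiseF_zero, Matrix.mul_zero, Matrix.mul_zero, add_zero,
    add_zero, Matrix.fromBlocks_inj] at h
  exact ⟨h.1, h.2.2.1⟩

/-- [folklore] **`K̂·Π̂ = K̂`** — the curvature block is blind to the block-mean dressing on the right. -/
theorem Khat_mul_PiHat (hr : r ∈ box (d + 1) n) : Khat (d := d) n p * PiHat r n p = Khat (d := d) n p :=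
  (Khat_mul_PiHat_and r n p hr).1

/-- [folklore] **`𝒬̂·Π̂ = 𝒬̂`** — `𝒬 ∘ Π_bm = 𝒬` on the torus. -/
theorem Qhat_mul_PiHat (hr : r ∈ box (d + 1) n) : Qhat (d := d) n p * PiHat r n p = Qhat (d := d) n p :=
  (Khat_mul_PiHat_and r n p hr).2

/-- [folklore] **THE WARD LETTER (a0) ON THE TORUS: `K̂·Ŵ₀ = 0`.** -/
theorem Khat_mul_What0 (hr : r ∈ box (d + 1) n) : Khat (d := d) n p * What0 r n p = 0 := by
  rw [What0, ← Matrix.mul_assoc, Matrix.mul_sub, Matrix.mul_one, Khat_mul_PiHat r n p hr, sub_self, Matrix.zero_mul]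

/-- [folklore] **THE WARD LETTER (b0) ON THE TORUS: `𝒬̂·Ŵ₀ = 0`.** -/
theorem Qhat_mul_What0 (hr : r ∈ box (d + 1) n) : Qhat (d := d) n p * What0 r n p = 0 := by
  rw [What0, ← Matrix.mul_assoc, Matrix.mul_sub, Matrix.mul_one, Qhat_mul_PiHat r n p hr, sub_self, Matrix.zero_mul]

end Summit.QuantumFields.BalabanUV.Beta.D1BFx.TorusGaugeBasis

end
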